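import Summits.QuantumFields.YangMills.Theorems.BalabanUVNodesK0AxCauchyDecouplingLocality

/-!
# NODE O — LENS-1 «cauchy-analytic» g12 — PRODUCT RULE and ORDER-INDEPENDENCE of the decoupling differences (companion 3 of `nodeO-cover/LENS-1-NODE-v13p2.md`, print [II] (2.10))

LANDING NOTE (porter ▶ PTC-1 g4, 2026-08-31; AUTHORSHIP = ◇ lens-1 g12 «cauchy-analytic», HOME sketch `nodeO-cover/LENS-1g12-CauchyDecouplingProduct-v1.lean` sha16 d0e43b0cb9718011 · 105 l. · 9
thm · no def · 0 sorry (CANDIDATE 12: print [II] (2.10) «H(Z) = Π H(Z_i)» on the level of decoupling differences — `decDiffList` depends on the SUBSET only (`decDiffList_perm`), splits along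
appends, and the activity of a set whose blocks have disjoint parameters is the PRODUCT of the block activities (`decDiffList_append_mul`); companion of ✓p824330 ∕ ✓p824499)): landed VERBATIM
(only this paragraph added) under the basename ◇ proposed (`…Theorems/BalabanUVNodesK0AxCauchyDecouplingProduct.lean`, same ns `…Theorems.K0AxCauchyDecoupling`) as INTENT-74; one import ✓p824499
`…K0AxCauchyDecouplingLocality`; `--supports stmt-QuantumFields-27930 --as helper` (NO `--workitem`; kind proof); ◆ CRIT-1 g38's cut: «(b) CUT CANDIDATE 12 → GO VERBATIM; 9 thm ∕ 0 def, every decl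
docstringed, cite first tokens bib keys; axioms standard on 8 guarded names; J4: 8 × 0, `indepOf_mul` only as a private ∕ differently-typed decl elsewhere (no fqn clash); J1′∕J5′: pure
finite-difference algebra; SAME-WALL: located S-brick (representation layer), B-list unchanged» (nodeO STATUS 2026-08-31T13:55:36Z).  HONEST (porter): elementary finite-difference algebra,
kernel-checked — proves NOTHING of Bałaban; ⟨27930⟩ `stub_FE` ∕ FE-2 OPEN; K0ᴬ stmt-QuantumFields-27238 OPEN; NODE O 0∕1; COUNT 8∕28 · K 1∕4 UNMOVED; finite 𝕋⁴ at fixed ε — NOT continuum ∕ OS ∕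
Clay; the Yang–Mills mass gap is NOT proved by any of this.

Cell `ym-nodeO-ideate`, LENS IDEATOR seat `ymgap-nodeO-lens-1-g12` (count-neutral).  Builds on the landed bricks ✓p824330 `…K0AxCauchyDecoupling` (`decDiff`, `decDiffList`) and
✓p824499 `…K0AxCauchyDecouplingLocality` (`IndepOf`, `indepOf_decDiffList`).

WHY.  Print [Balaban1988RG2Cluster] (2.10) p.14: *"if Z = Z₁ ∪ … ∪ Z_n, where Z_i is a connected component of Z, then H(Z) = Π_i H(Z_i)"* — the activity of a disconnected set is the PRODUCT
of the activities of its components, which turns the expansion (2.9) into the polymer gas (2.11).  On the level of decoupling differences this is the product rule below: if `G` ignores the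
parameters of `l₂` and `H` ignores those of `l₁`, then the mixed difference of `G·H` along `l₁ ++ l₂` is `(Δ_{l₁} G)·(Δ_{l₂} H)`.  Together with ✓`decDiffList_eq_zero_of_indepOf` (only sets
all of whose variables are «seen» survive) this is the representation layer of print's ACTIVITY route ((2.9)–(2.11): expand the fluctuation RATIO, not its log); the LOG route of NODE v13.2 uses
✓`decDiffList_sum_eq_zero_of_componentwise` instead.  Also filed: differences in distinct parameters COMMUTE, so `Δ_l` depends on `l` only up to permutation (`decDiffList_perm`) — the
finite-difference form of the symmetry of mixed partial derivatives that (1.9)–(1.10) use silently.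
* `decDiff_comm`, ★ `decDiffList_perm`, `decDiffList_append`;
* `indepOf_mul`, `decDiff_mul_of_indepOf_right∕left`, `decDiffList_mul_of_indepOf_right∕left`;
* ★★ `decDiffList_append_mul` — `Δ_{l₁++l₂} (G·H) = Δ_{l₁} G · Δ_{l₂} H` when `G` ignores `l₂`, `H` ignores `l₁`, and `l₁`, `l₂` share no parameter.
HONEST FRAMING.  Elementary algebra of finite differences, kernel-checked; nothing of Bałaban is asserted, ported or discharged (the MODEL statement that the s-weakened ratio factorises over
components at `s = 0` off `Z` — N2b′ — is DEF-1's stage-2 Fubini face, not here); `stub_FE` ∕ `stub_P0C` ∕ `stub_G3C` OPEN; 27930 OPEN; K0ᴬ ∕ NODE O 0∕1; finite tori at fixed ε — NOT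
continuum ∕ OS; **the Yang–Mills mass gap (Clay) is NOT proved by any of this.**  No `sorry`, no `instance`, no `notation`, no `def`; standard axioms.
-/

noncomputable section

open Function

namespace Summit.QuantumFields.YangMills.Theorems.K0AxCauchyDecoupling

variable {ι : Type*} [DecidableEq ι]

/-! ## §1  Differences in distinct parameters commute; `Δ_l` is permutation-invariant -/

/-- `Δ_y Δ_{y'} = Δ_{y'} Δ_y` (bookkeeping: `update` commutes on distinct coordinates; equal coordinates trivially). [cite: Balaban1988RG2Cluster, (1.9)–(1.10) p.4 (mixed derivatives in the parameters s; locator)] -/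
theorem decDiff_comm (y y' : ι) (G : (ι → ℂ) → ℂ) : decDiff y (decDiff y' G) = decDiff y' (decDiff y G) := by
  by_cases h : y = y'
  · subst h; rfl
  · funext s
    simp only [decDiff]
    rw [update_comm h, update_comm h, update_comm h, update_comm h]
    ring

/-- ★ **`Δ_l` depends on the list of parameters only up to PERMUTATION.** [cite: Balaban1988RG2Cluster, (1.9)–(1.10) p.4 (the sum is over SUBSETS σ; locator)] -/
theorem decDiffList_perm {l l' : List ι} (h : l.Perm l') (G : (ι → ℂ) → ℂ) : decDiffList l G = decDiffList l' G := by
  induction h generalizing G with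
  | nil => rfl
  | cons y _ ih => simp [decDiffList, ih]
  | swap y y' l => simpa [decDiffList] using decDiff_comm y' y (decDiffList l G)
  | trans _ _ ih₁ ih₂ => exact (ih₁ G).trans (ih₂ G)

/-- `Δ_{l₁ ++ l₂} = Δ_{l₁} ∘ Δ_{l₂}` (bookkeeping). -/
theorem decDiffList_append (G : (ι → ℂ) → ℂ) : ∀ l₁ l₂ : List ι, decDiffList (l₁ ++ l₂) G = decDiffList l₁ (decDiffList l₂ G)
  | [], l₂ => by simp
  | y :: l₁, l₂ => by simp [decDiffList, decDiffList_append G l₁ l₂]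

/-! ## §2  Product rule against a factor that ignores the differenced parameter -/

/-- A product of two functions ignoring `y` ignores `y` (bookkeeping). -/
theorem indepOf_mul {y : ι} {G H : (ι → ℂ) → ℂ} (hG : IndepOf y G) (hH : IndepOf y H) : IndepOf y (G * H) := by
  intro s t
  simp only [Pi.mul_apply, hG s t, hH s t]

/-- `Δ_y (G·H) = (Δ_y G)·H` when `H` ignores `y`. [cite: Balaban1988RG2Cluster, (2.10) p.14 «H(Z) = Π H(Z_i)» (locator; the factor of another component is a constant for ∂∕∂s)] -/
theorem decDiff_mul_of_indepOf_right {y : ι} (G : (ι → ℂ) → ℂ) {H : (ι → ℂ) → ℂ} (hH : IndepOf y H) :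
    decDiff y (G * H) = decDiff y G * H := by
  funext s
  simp only [decDiff, Pi.mul_apply, hH s 1, hH s 0]
  ring

/-- `Δ_y (G·H) = G·(Δ_y H)` when `G` ignores `y`. [cite: Balaban1988RG2Cluster, (2.10) p.14 (locator)] -/
theorem decDiff_mul_of_indepOf_left {y : ι} {G : (ι → ℂ) → ℂ} (hG : IndepOf y G) (H : (ι → ℂ) → ℂ) :
    decDiff y (G * H) = G * decDiff y H := by
  funext s
  simp only [decDiff, Pi.mul_apply, hG s 1, hG s 0]
  ring

/-- `Δ_l (G·H) = (Δ_l G)·H` when `H` ignores every parameter of `l`. [cite: Balaban1988RG2Cluster, (2.10) p.14 (locator)] -/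
theorem decDiffList_mul_of_indepOf_right (G : (ι → ℂ) → ℂ) {H : (ι → ℂ) → ℂ} :
    ∀ {l : List ι}, (∀ y ∈ l, IndepOf y H) → decDiffList l (G * H) = decDiffList l G * H
  | [], _ => by simp
  | y :: l, h => by
      have hl : ∀ y' ∈ l, IndepOf y' H := fun y' hy' => h y' (List.mem_cons_of_mem y hy')
      simp only [decDiffList, decDiffList_mul_of_indepOf_right G hl]
      exact decDiff_mul_of_indepOf_right _ (h y List.mem_cons_self)

/-- `Δ_l (G·H) = G·(Δ_l H)` when `G` ignores every parameter of `l`. [cite: Balaban1988RG2Cluster, (2.10) p.14 (locator)] -/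
theorem decDiffList_mul_of_indepOf_left {G : (ι → ℂ) → ℂ} (H : (ι → ℂ) → ℂ) :
    ∀ {l : List ι}, (∀ y ∈ l, IndepOf y G) → decDiffList l (G * H) = G * decDiffList l H
  | [], _ => by simp
  | y :: l, h => by
      have hl : ∀ y' ∈ l, IndepOf y' G := fun y' hy' => h y' (List.mem_cons_of_mem y hy')
      simp only [decDiffList, decDiffList_mul_of_indepOf_left H hl]
      exact decDiff_mul_of_indepOf_left (h y List.mem_cons_self) _

/-- ★★ **PRODUCT RULE OVER DISJOINT PARAMETER BLOCKS** — print's (2.10) on the level of decoupling differences: if `G` ignores the parameters of `l₂`, `H` ignores those of `l₁`, and the two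
lists share no parameter, then `Δ_{l₁ ++ l₂} (G·H) = (Δ_{l₁} G)·(Δ_{l₂} H)`.  (With ✓`decDiffList_perm` the concatenation order is immaterial.)
[cite: Balaban1988RG2Cluster, (2.10)–(2.11) p.14 «H(Z) = Π H(Z_i)» ⇒ the polymer gas] -/
theorem decDiffList_append_mul {G H : (ι → ℂ) → ℂ} {l₁ l₂ : List ι}
    (hG : ∀ y ∈ l₂, IndepOf y G) (hH : ∀ y ∈ l₁, IndepOf y H) (hd : ∀ y ∈ l₁, y ∉ l₂) :
    decDiffList (l₁ ++ l₂) (G * H) = decDiffList l₁ G * decDiffList l₂ H := by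
  rw [decDiffList_append, decDiffList_mul_of_indepOf_left H hG]
  exact decDiffList_mul_of_indepOf_right G fun y hy => indepOf_decDiffList (hH y hy) (hd y hy)

end Summit.QuantumFields.YangMills.Theorems.K0AxCauchyDecoupling

end
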